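import Summits.BirchSwinnertonDyer.BirchSwinnertonDyer.Theses.PrintCf2
import Summits.BirchSwinnertonDyer.BirchSwinnertonDyer.Theorems.PrintCf2RamifiedOffTYZSelmerRankOneSixAll
import HarnessLib

/-!
# Route `PrintCf2`, aside stmt-BirchSwinnertonDyer-23441 `RamifiedSelmerEightSixAllOfFacts` — CLOSER BY NAME

The aside filed by planner g21 (route A rev 52) under crux stmt-BirchSwinnertonDyer-20509 / item 23432 (C⁺ lower half, the
`S(6)` stratum): for square-free `n ≡ 6 (mod 8)`, `n = 2·p₁⋯p_k` (distinct odd primes, any `k`) whose even Monsky matrix has an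
adjugate entry `1` in an `(inl i, inr i)` position, `#Sel₂(E_n) = 8 ⟹ ord_{s=1} L(E_n, s) = 1`, `rank E_n(ℚ) = 1`, `Ш(E_n)[2^∞] = 0`
and `BSD(E_n, 2)` — modulo the two TYZ inputs `tyz_cmPointRingClassFrobeniusValueData ∧ thm11_parity_of_scriptL`.
Proved BY NAME by the regime-free mover-chain theorem
`Summit.BirchSwinnertonDyer.PrintCf2.MoverAssembly.selmerEight_mod_eight_six_bsdp_two_all_of_facts` of the crux LEAD
(cruxlead-20509 g13, p744989), whose type is the item text VERBATIM.  CONDITIONAL on the two named facts (hypotheses of the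
statement, no `_holds`); crux 20509 / items 23431–23432 are NOT closed by this file; BSD is not proved by any of this.

References: [cite: TianYuanZhang2017, Thm. 1.1, §3.1, Prop. 3.2 (2), Thm. 3.5, Thm. 3.6 (2), Lemma 3.18, proof of Lemma 3.21];
[cite: HeathBrown1994SelmerCongruentII, Appendix (Monsky)]; [cite: Miller2011LMS, Def. 1.1].
-/

set_option linter.dupNamespace false

namespace Summit.BirchSwinnertonDyer.BirchSwinnertonDyer.Theorems

/-- **Aside `RamifiedSelmerEightSixAllOfFacts` (stmt-BirchSwinnertonDyer-23441), by name**: granted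
`tyz_cmPointRingClassFrobeniusValueData ∧ thm11_parity_of_scriptL`, for every square-free `n ≡ 6 (mod 8)` with an even Monsky
matrix having an adjugate entry `1` at some `(inl i, inr i)` and `#Sel₂(E_n) = 8`: `ord_{s=1} L(E_n, s) = 1`, `rank E_n(ℚ) = 1`,
`Ш(E_n)[2^∞] = 0` and `BSD(E_n, 2)`.
[cite: TianYuanZhang2017, Thm. 1.1 and §3 (Prop. 3.2 (2), Thm. 3.5, Thm. 3.6 (2), Lemma 3.18, proof of Lemma 3.21)]
[cite: HeathBrown1994SelmerCongruentII, Appendix (Monsky)] [cite: Miller2011LMS, Def. 1.1] -/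
theorem ramifiedSelmerEightSixAllOfFacts_proof :
    Summit.BirchSwinnertonDyer.BirchSwinnertonDyer.Theses.PrintCf2.RamifiedSelmerEightSixAllOfFacts := by
  unfold Summit.BirchSwinnertonDyer.BirchSwinnertonDyer.Theses.PrintCf2.RamifiedSelmerEightSixAllOfFacts
  exact Summit.BirchSwinnertonDyer.PrintCf2.MoverAssembly.selmerEight_mod_eight_six_bsdp_two_all_of_facts

end Summit.BirchSwinnertonDyer.BirchSwinnertonDyer.Theorems
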